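import Mathlib
import HarnessLib

/-!
# Stub `stub_transferAlgebra` of the line `birth` — crux `NeutralTaylorWaves.NonresonantSelection`
# (stmt-AnomalousDissipation-16294)

The pure real-arithmetic endgame (`κ = 1/16`, `A = 2`) of the Kato-type perturbation argument
`borderedGapStability` of the skeleton `Cruxes/NonresonantSelection/Lines/birth.lean`.
Letters: `E = ‖v‖₂²`, `b` the drift unknown, `P = ‖F‖₂²` the bordered residual at the perturbed
base and `g` the border pairing there, `P₁, g₁` the same two quantities at the reference base (the
spine),
`D = ‖∇v‖₂²`, `M` the constant of the bordered a-priori bound at the spine, `G = sup ‖∇w‖`, `δ` the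
distance of the two bases, `ν` the viscosity.

Proof. Put `X := √(E + b²)`, `Y := √(P + g²)`, `Y₁ := √(P₁ + g₁²)`, `s := √ν`; then `√E, |b| ≤ X`
and `√P, |g| ≤ Y`.
1. Energy: `νD ≤ √P√E + 3GE + |b||g| ≤ 2XY + 3GX² ≤ (Y + (1+2G)X)²`, so `s√D ≤ Y + (1+2G)X`.
2. Perturbation and Minkowski in `ℝ²`: `Y₁ ≤ Y + δ(2√D + 3√E + |b|)`.
3. Spine bound: `X ≤ M Y₁`.
4. Smallness `δ(1+M)(1+G) ≤ ν/16`, `ν ≤ 1`: `Mδ ≤ ν/16`, `Mδ(1+2G) ≤ ν/8`, whence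
   `Mδ√D ≤ Y/16 + X/8` and `X ≤ MY + Y/8 + X/2`, i.e. `X ≤ (2M + 1/4)Y ≤ 2(1+M)Y`; square.
-/

-- `Summit.<Summit>.<Problem>` is the tree's mandated summit-side namespace; for this single-conjunct
-- summit the two segments coincide, so the duplicate is deliberate.
set_option linter.dupNamespace false

noncomputable section

namespace Summit.AnomalousDissipation.AnomalousDissipation.Theorems

/-- Cauchy–Schwarz in `ℝ²`: `a₁a₂ + b₁b₂ ≤ √(a₁² + b₁²) · √(a₂² + b₂²)`. -/
theorem nonresonantSelection_alg_cauchySchwarz_two (a₁ a₂ b₁ b₂ : ℝ) :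
    a₁ * a₂ + b₁ * b₂ ≤ Real.sqrt (a₁ ^ 2 + b₁ ^ 2) * Real.sqrt (a₂ ^ 2 + b₂ ^ 2) := by
  have h : (a₁ * a₂ + b₁ * b₂) ^ 2 ≤ (a₁ ^ 2 + b₁ ^ 2) * (a₂ ^ 2 + b₂ ^ 2) := by
    nlinarith [sq_nonneg (a₁ * b₂ - a₂ * b₁)]
  have h' := Real.abs_le_sqrt h
  rw [Real.sqrt_mul (by positivity)] at h'
  exact (le_abs_self _).trans h'

/-- Minkowski in `ℝ²`: `√((a₁+a₂)² + (b₁+b₂)²) ≤ √(a₁² + b₁²) + √(a₂² + b₂²)`. -/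
theorem nonresonantSelection_alg_minkowski_two (a₁ a₂ b₁ b₂ : ℝ) :
    Real.sqrt ((a₁ + a₂) ^ 2 + (b₁ + b₂) ^ 2) ≤
      Real.sqrt (a₁ ^ 2 + b₁ ^ 2) + Real.sqrt (a₂ ^ 2 + b₂ ^ 2) := by
  have hu0 : 0 ≤ Real.sqrt (a₁ ^ 2 + b₁ ^ 2) := Real.sqrt_nonneg _
  have hv0 : 0 ≤ Real.sqrt (a₂ ^ 2 + b₂ ^ 2) := Real.sqrt_nonneg _
  have hu2 : Real.sqrt (a₁ ^ 2 + b₁ ^ 2) ^ 2 = a₁ ^ 2 + b₁ ^ 2 := Real.sq_sqrt (by positivity)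
  have hv2 : Real.sqrt (a₂ ^ 2 + b₂ ^ 2) ^ 2 = a₂ ^ 2 + b₂ ^ 2 := Real.sq_sqrt (by positivity)
  have hcs := nonresonantSelection_alg_cauchySchwarz_two a₁ a₂ b₁ b₂
  have hle : (a₁ + a₂) ^ 2 + (b₁ + b₂) ^ 2 ≤
      (Real.sqrt (a₁ ^ 2 + b₁ ^ 2) + Real.sqrt (a₂ ^ 2 + b₂ ^ 2)) ^ 2 := by
    nlinarith [hcs, hu2, hv2]
  calc Real.sqrt ((a₁ + a₂) ^ 2 + (b₁ + b₂) ^ 2)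
      ≤ Real.sqrt ((Real.sqrt (a₁ ^ 2 + b₁ ^ 2) + Real.sqrt (a₂ ^ 2 + b₂ ^ 2)) ^ 2) :=
        Real.sqrt_le_sqrt hle
    _ = Real.sqrt (a₁ ^ 2 + b₁ ^ 2) + Real.sqrt (a₂ ^ 2 + b₂ ^ 2) :=
        Real.sqrt_sq (add_nonneg hu0 hv0)

/-- **Stub `stub_transferAlgebra`** (line `birth` of crux `NeutralTaylorWaves.NonresonantSelection`,
stmt-AnomalousDissipation-16294) — THE TRANSFER ALGEBRA (`κ = 1/16`, `A = 2`). With `X² = E + b²`,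
`Y² = P + g²`, `Y₁² = P₁ + g₁²`: the spine bound `X ≤ M Y₁`, the energy inequality
`νD ≤ √P√E + 3GE + |b||g|` (so `√ν √D ≤ Y + (1+2G)X`), the perturbation bounds
`√P₁ ≤ √P + δ(2√D + 2√E + |b|)`, `|g₁ − g| ≤ δ√E` (so, by Minkowski in `ℝ²`,
`Y₁ ≤ Y + δ(2√D + 3√E + |b|)`) and the smallness `δ(1+M)(1+G) ≤ ν/16`, `ν ≤ 1` give
`X ≤ (M + 1/8)Y + X/2`, hence `X ≤ 2(1+M)Y` and `E + b² = X² ≤ (2(1+M))² (P + g²)`. -/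
theorem stub_transferAlgebra :
    ∀ (ν M G δ E b P g P₁ g₁ D : ℝ),
      0 < ν → ν ≤ 1 → 0 ≤ M → 0 ≤ G → 0 ≤ δ → 0 ≤ E → 0 ≤ P → 0 ≤ P₁ → 0 ≤ D →
      δ * (1 + M) * (1 + G) ≤ ν / 16 →
      E + b ^ 2 ≤ M ^ 2 * (P₁ + g₁ ^ 2) →
      ν * D ≤ Real.sqrt P * Real.sqrt E + 3 * G * E + |b| * |g| →
      Real.sqrt P₁ ≤ Real.sqrt P + δ * (2 * Real.sqrt D + 2 * Real.sqrt E + |b|) →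
      |g₁ - g| ≤ δ * Real.sqrt E →
      E + b ^ 2 ≤ (2 * (1 + M)) ^ 2 * (P + g ^ 2) := by
  intro ν M G δ E b P g P₁ g₁ D hν hν1 hM hG hδ hE hP hP₁ _hD hsmall hgap hen hres hbor
  -- the four square roots `X, Y, Y₁, s`
  obtain ⟨X, hXdef⟩ : ∃ X, X = Real.sqrt (E + b ^ 2) := ⟨_, rfl⟩
  obtain ⟨Y, hYdef⟩ : ∃ Y, Y = Real.sqrt (P + g ^ 2) := ⟨_, rfl⟩
  obtain ⟨Y₁, hY₁def⟩ : ∃ Y₁, Y₁ = Real.sqrt (P₁ + g₁ ^ 2) := ⟨_, rfl⟩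
  obtain ⟨s, hsdef⟩ : ∃ s, s = Real.sqrt ν := ⟨_, rfl⟩
  have hX0 : 0 ≤ X := by rw [hXdef]; exact Real.sqrt_nonneg _
  have hY0 : 0 ≤ Y := by rw [hYdef]; exact Real.sqrt_nonneg _
  have hX2 : X ^ 2 = E + b ^ 2 := by rw [hXdef]; exact Real.sq_sqrt (by positivity)
  have hY2 : Y ^ 2 = P + g ^ 2 := by rw [hYdef]; exact Real.sq_sqrt (by positivity)
  have hs0 : 0 < s := by rw [hsdef]; exact Real.sqrt_pos.2 hν
  have hs2 : s ^ 2 = ν := by rw [hsdef]; exact Real.sq_sqrt hν.le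
  have hs1 : s ≤ 1 := by rw [hsdef]; exact Real.sqrt_le_one.2 hν1
  have hsE0 : 0 ≤ Real.sqrt E := Real.sqrt_nonneg _
  have hsE_X : Real.sqrt E ≤ X := by
    rw [hXdef]; exact Real.sqrt_le_sqrt (by linarith [sq_nonneg b])
  have hb_X : |b| ≤ X := by
    rw [hXdef]; exact Real.abs_le_sqrt (by linarith)
  have hsP_Y : Real.sqrt P ≤ Y := by
    rw [hYdef]; exact Real.sqrt_le_sqrt (by linarith [sq_nonneg g])
  have hg_Y : |g| ≤ Y := by
    rw [hYdef]; exact Real.abs_le_sqrt (by linarith)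
  -- Step 1: the energy inequality gives `s √D ≤ Y + (1 + 2G) X`
  have hE_X2 : E ≤ X ^ 2 := by rw [hX2]; linarith [sq_nonneg b]
  have hPE : Real.sqrt P * Real.sqrt E ≤ Y * X := mul_le_mul hsP_Y hsE_X hsE0 hY0
  have hbg : |b| * |g| ≤ X * Y := mul_le_mul hb_X hg_Y (abs_nonneg g) hX0
  have hGE : G * E ≤ G * X ^ 2 := mul_le_mul_of_nonneg_left hE_X2 hG
  have hνD : ν * D ≤ (Y + (1 + 2 * G) * X) ^ 2 := by
    linarith [hen, hPE, hbg, hGE, mul_nonneg (mul_nonneg hG hX0) hY0, sq_nonneg Y,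
      mul_nonneg hG (sq_nonneg X), sq_nonneg X, mul_nonneg (sq_nonneg G) (sq_nonneg X)]
  have hW0 : 0 ≤ Y + (1 + 2 * G) * X := add_nonneg hY0 (mul_nonneg (by linarith) hX0)
  have hsD : s * Real.sqrt D ≤ Y + (1 + 2 * G) * X := by
    have h := Real.sqrt_le_sqrt hνD
    rwa [Real.sqrt_mul hν.le, Real.sqrt_sq hW0, ← hsdef] at h
  -- Step 2: perturbation and Minkowski in `ℝ²`: `Y₁ ≤ Y + δ (2√D + 3√E + |b|)`
  have hR0 : 0 ≤ δ * (2 * Real.sqrt D + 2 * Real.sqrt E + |b|) := by positivity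
  have hδE0 : 0 ≤ δ * Real.sqrt E := mul_nonneg hδ hsE0
  have hg₁ : |g₁| ≤ |g| + δ * Real.sqrt E := by
    have := abs_sub_abs_le_abs_sub g₁ g
    linarith
  have hP₁le : P₁ ≤ (Real.sqrt P + δ * (2 * Real.sqrt D + 2 * Real.sqrt E + |b|)) ^ 2 := by
    have h := pow_le_pow_left₀ (Real.sqrt_nonneg P₁) hres 2
    rwa [Real.sq_sqrt hP₁] at h
  have hg₁le : g₁ ^ 2 ≤ (|g| + δ * Real.sqrt E) ^ 2 := by
    have h := pow_le_pow_left₀ (abs_nonneg g₁) hg₁ 2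
    rwa [sq_abs] at h
  have hY₁le : Y₁ ≤ Y + δ * (2 * Real.sqrt D + 3 * Real.sqrt E + |b|) := by
    have hmink := nonresonantSelection_alg_minkowski_two (Real.sqrt P)
      (δ * (2 * Real.sqrt D + 2 * Real.sqrt E + |b|)) |g| (δ * Real.sqrt E)
    rw [Real.sq_sqrt hP, sq_abs, ← hYdef] at hmink
    have htail : Real.sqrt ((δ * (2 * Real.sqrt D + 2 * Real.sqrt E + |b|)) ^ 2 +
        (δ * Real.sqrt E) ^ 2) ≤
        δ * (2 * Real.sqrt D + 2 * Real.sqrt E + |b|) + δ * Real.sqrt E := by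
      rw [Real.sqrt_le_left (add_nonneg hR0 hδE0)]
      linarith [mul_nonneg hR0 hδE0]
    calc Y₁ = Real.sqrt (P₁ + g₁ ^ 2) := hY₁def
      _ ≤ Real.sqrt ((Real.sqrt P + δ * (2 * Real.sqrt D + 2 * Real.sqrt E + |b|)) ^ 2 +
            (|g| + δ * Real.sqrt E) ^ 2) := Real.sqrt_le_sqrt (add_le_add hP₁le hg₁le)
      _ ≤ Y + Real.sqrt ((δ * (2 * Real.sqrt D + 2 * Real.sqrt E + |b|)) ^ 2 +
            (δ * Real.sqrt E) ^ 2) := hmink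
      _ ≤ Y + (δ * (2 * Real.sqrt D + 2 * Real.sqrt E + |b|) + δ * Real.sqrt E) :=
          add_le_add le_rfl htail
      _ = Y + δ * (2 * Real.sqrt D + 3 * Real.sqrt E + |b|) := by ring
  -- Step 3: the spine bound `X ≤ M Y₁`
  have hXle : X ≤ M * Y₁ := by
    have h := Real.sqrt_le_sqrt hgap
    rwa [Real.sqrt_mul (sq_nonneg M), Real.sqrt_sq hM, ← hXdef, ← hY₁def] at h
  -- Step 4: smallness and combination
  have hMδ : M * δ ≤ ν / 16 := by
    linarith [mul_nonneg hδ hG, mul_nonneg (mul_nonneg hδ hM) hG]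
  have hMδG : M * δ * (1 + 2 * G) ≤ ν / 8 := by
    linarith [mul_nonneg hδ hG, mul_nonneg hδ hM]
  have hMδ0 : 0 ≤ M * δ := mul_nonneg hM hδ
  have hT : M * δ * Real.sqrt D ≤ Y / 16 + X / 8 := by
    -- `s (Mδ√D) ≤ Mδ (Y + (1+2G)X) ≤ (ν/16) Y + (ν/8) X = s (s (Y/16 + X/8))`
    have h1 : s * (M * δ * Real.sqrt D) ≤ M * δ * (Y + (1 + 2 * G) * X) := by
      have := mul_le_mul_of_nonneg_left hsD hMδ0
      linarith
    have hA : M * δ * Y ≤ ν / 16 * Y := mul_le_mul_of_nonneg_right hMδ hY0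
    have hB : M * δ * (1 + 2 * G) * X ≤ ν / 8 * X := mul_le_mul_of_nonneg_right hMδG hX0
    have h2 : s * (M * δ * Real.sqrt D) ≤ s * (s * (Y / 16 + X / 8)) := by
      have hνs : s * (s * (Y / 16 + X / 8)) = ν * (Y / 16 + X / 8) := by rw [← hs2]; ring
      rw [hνs]
      linarith
    have h3 : M * δ * Real.sqrt D ≤ s * (Y / 16 + X / 8) := le_of_mul_le_mul_left h2 hs0
    have h4 : s * (Y / 16 + X / 8) ≤ Y / 16 + X / 8 :=
      mul_le_of_le_one_left (by positivity) hs1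
    linarith
  have hδE : M * δ * Real.sqrt E ≤ M * δ * X := mul_le_mul_of_nonneg_left hsE_X hMδ0
  have hδb : M * δ * |b| ≤ M * δ * X := mul_le_mul_of_nonneg_left hb_X hMδ0
  have hMδX : M * δ * X ≤ X / 16 := by
    have h1 := mul_le_mul_of_nonneg_right hMδ hX0
    have h2 : ν * X ≤ X := mul_le_of_le_one_left hX0 hν1
    linarith
  have hXY : X ≤ 2 * (1 + M) * Y := by
    have hmain : X ≤ M * (Y + δ * (2 * Real.sqrt D + 3 * Real.sqrt E + |b|)) :=
      hXle.trans (mul_le_mul_of_nonneg_left hY₁le hM)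
    have hexp : M * (Y + δ * (2 * Real.sqrt D + 3 * Real.sqrt E + |b|)) =
        M * Y + 2 * (M * δ * Real.sqrt D) + 3 * (M * δ * Real.sqrt E) + M * δ * |b| := by ring
    rw [hexp] at hmain
    linarith
  -- conclusion: square `X ≤ 2 (1 + M) Y`
  have hfin : X ^ 2 ≤ (2 * (1 + M) * Y) ^ 2 := pow_le_pow_left₀ hX0 hXY 2
  calc E + b ^ 2 = X ^ 2 := hX2.symm
    _ ≤ (2 * (1 + M) * Y) ^ 2 := hfin
    _ = (2 * (1 + M)) ^ 2 * (P + g ^ 2) := by rw [← hY2]; ring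

end Summit.AnomalousDissipation.AnomalousDissipation.Theorems
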